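import Literature.Probability.LatticeModels.PlaneRotatorStiffnessCutCovariance
import Literature.Probability.LatticeModels.PlaneRotatorComponentCorrelationInequality
import Literature.Probability.LatticeModels.PlaneRotatorLiebCriterion
import Literature.Probability.LatticeModels.PlaneRotatorPathFloor
import Mathlib.Analysis.SpecificLimits.Normed
import Literature.MathematicalPhysics.QuantumLattice.MobilityGap
import HarnessLib

/-!
# The torus helicity modulus vanishes exponentially in Lieb's high-temperature phase:
# `|βΥ_L(K)| ≤ 4K²L²·(4u(K))^{2(⌊L/2⌋−1)}`, `u = I₁/I₀`, for the plane rotator on `(ℤ/Lℤ)²`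

Topic `Literature/Probability/LatticeModels`. The composition of three tree inputs:

* the **cut–cut covariance identity** `βΥ_L(K) = −K²⟨J_{C_j} J_{C_{j'}}⟩_{K,L}` for two distinct column cuts
  (`torusXYStiffness_eq_neg_sq_mul_cutCurrent_covariance`, `PlaneRotatorStiffnessCutCovariance.lean`,
  Fisher–Barber–Jasnow 1973 §II / Sandvik 2010);
* the **component correlation inequality** of Dunlop–Kunz–Pfister–Vuillermot / Bricmont–Fontaine–Landau 1977
  Thm A2 in the form of the bond-current decoupling `|⟨sin∇θ_{aa'} sin∇θ_{cc'}⟩_J| ≤ 2(G(a,c)G(a',c') +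
  G(a,c')G(a',c))`, `G = ⟨cos(θ_x − θ_y)⟩` (`abs_expectJ_imChar_mul_imChar_le_cosDiff`,
  `PlaneRotatorComponentCorrelationInequality.lean`);
* **Lieb's Bessel-ratio criterion** `⟨cos(θ_a − θ_c)⟩ ≤ A₀^{d(a)}` whenever the two-spin row sums are `≤ A₀` and `d` is
  `1`-Lipschitz along the bonds (`PlaneRotator.twoPoint_le_pow_of_besselRatio_rowSum_le`, Lieb 1980 Thm 4 with
  Rivasseau 1980; `PlaneRotatorLiebCriterion.lean`).

## Contents (everything PROVED; no definition, no named fact)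

* §1 The torus row sums: for `L ≥ 3` every site of `(ℤ/Lℤ)²` has Bessel-ratio row sum exactly `≤ 4u(K)`
  (`torusXY_besselRatio_rowSum_le`; the fibre-summed pair coupling of `torusXY 2 L` is `K` on the `4` neighbour
  pairs, in one orientation each, and `0` elsewhere).
* §2 The column distance `d_c(x) = dist_{ℤ/Lℤ}(x₁, c₁)` (`Mathlib`'s `ZMod.valMinAbs`) is `1`-Lipschitz along the
  bonds, whence **Lieb's bound on the torus**: `0 ≤ ⟨cos(θ_a − θ_c)⟩_{K,L} ≤ (4u(K))^{d_c(a)}` for all `L ≥ 3`,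
  `K ≥ 0` (`torusXY_expectJ_cosDiff_le_pow_colDist`).
* §3 **Main theorem** (`abs_torusXYStiffness_le_lieb`): for `L ≥ 4`, `K ≥ 0` with `4u(K) ≤ 1`,
  `|βΥ_L(K)| ≤ 4K²L²·(4u(K))^{2(⌊L/2⌋−1)}` — cuts `j = 0`, `j' = ⌊L/2⌋`; the `L²` bond pairs across the two
  cuts each contribute at most `4·(4u)^{2(⌊L/2⌋−1)}` by the decoupling and §2 (all four column distances are
  `≥ ⌊L/2⌋ − 1`).
* §5 **Positivity** (`torusXYStiffness_pos`): `βΥ_L(K) > 0` for every `K > 0`, `L ≥ 1` — the straight winding loop in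
  the dual current representation (`torusXYStiffness_mul_card_mul_partitionFnJ_eq_tsum`).
* §6 **Crux corollary** (`torusXY_not_uniform_decay_stiffnessExponent`): for `K > 0` with `4u(K) < 1` no bound
  `|⟨cos(θ_x − θ_y)⟩_{K,L}| ≤ A·B^{η_L}(dist+1)^{−η_L}` with `η_L = 1/(2π βΥ_L(K))` holds for all `L ≥ 3` (§4 + §5 +
  the typing rule `torusXY_not_uniform_decay_of_tendsto`).
* §4 **Exponential vanishing** (`tendsto_torusXYStiffness_lieb`): for `K ≥ 0` with `4u(K) < 1` — i.e. `K < u⁻¹(¼) ≈ 0.51`,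
  `T > T_Lieb ≈ 1.96·J`, Lieb's whole high-temperature phase — `βΥ_L(K) → 0` as `L → ∞`; with the tree's floor
  `0 ≤ βΥ_L` (`torusXYStiffness_nonneg`). The ELEMENTARY TWIN with a Peierls argument in the current
  representation is `torusXYStiffness_le_highTemperature` / `tendsto_torusXYStiffness_of_lt_half`
  (`PlaneRotatorStiffnessHighTemperature.lean`, `K < ½`); the present file is the correlation-inequality engine,
  valid from `L = 4` on, with rate `(4u(K))^{L}` in place of `L⁶(2K)^L`.

Reading (cell `pub/hubbard-tc`, crux №2 classical side): a stiffness-class statement with `Υ_L` in the exponent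
and constants uniform in `L` is refuted throughout the high-temperature phase by the tree's typing rule
`torusXY_not_uniform_decay_of_tendsto` as soon as `Υ_L > 0` there (finite-volume positivity is the winding term of
`torusXYStiffness_mul_partitionFnJ_eq_tsum_winding`, not restated here); any Υ-in-the-exponent statement must
carry a low-temperature / stiffness-window hypothesis.

## References

* E. H. Lieb, Comm. Math. Phys. 77 (1980) 127, Theorem 4; V. Rivasseau, ibid. 145. [Lieb1980] [Rivasseau1980]
* J. Bricmont, J.-R. Fontaine, L. J. Landau, Comm. Math. Phys. 56 (1977) 281, Appendix Thm A2.
  [BricmontFontaineLandau1977]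
* M. E. Fisher, M. N. Barber, D. Jasnow, Phys. Rev. A 8 (1973) 1111, §II. [FisherBarberJasnow1973]

## What this is not

A classical comparison-model statement at HIGH temperature: nothing about electrons, `T_c`, or the low-temperature
phase (Fröhlich–Spencer); no number of the cell's tables moves; K2 (Kosterlitz–Thouless stability) untouched.
-/

noncomputable section

open MeasureTheory Finset Filter
open scoped BigOperators Topology

namespace Literature.Probability.LatticeModels

open PlaneRotator

variable {L : ℕ} [NeZero L]

/-! ## §1 The pair coupling and the Bessel-ratio row sums of the torus -/

section RowSum

omit [NeZero L] in
/-- Source and target of a torus bond. [cite: Lieb1980, Theorem 4 — plumbing] -/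
private theorem torusXY_src_tgt (b : TorusSite 2 L × Fin 2) :
    ((torusXY 2 L).src b, (torusXY 2 L).tgt b) = (b.1, b.1 + Pi.single b.2 1) := rfl

omit [NeZero L] in
/-- `ν ≥ 0`. [cite: Lieb1980, Theorem 4 — plumbing] -/
private theorem nbr_nonneg (x y : TorusSite 2 L) :
    0 ≤ (∑ i : Fin 2, if x + Pi.single i 1 = y then (1 : ℝ) else 0) :=
  Finset.sum_nonneg fun i _ => by split_ifs <;> norm_num

/-- **The fibre-summed pair coupling of the torus**: `J(x, y) = K·ν(x, y)`. [cite: Lieb1980, Theorem 4 (nearest-neighbour rotators on a hypercubic lattice)] -/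
private theorem pairCoupling_torusXY (K : ℝ) (x y : TorusSite 2 L) :
    (torusXY 2 L).pairCoupling (fun _ => K) (x, y) = K * (∑ i : Fin 2, if x + Pi.single i 1 = y then (1 : ℝ) else 0) := by
  unfold BondSystem.pairCoupling
  rw [Finset.sum_filter, Fintype.sum_prod_type, Finset.mul_sum]
  simp only [torusXY_src_tgt, Prod.mk.injEq]
  rw [Finset.sum_comm]
  refine Finset.sum_congr rfl fun i _ => ?_
  rw [show (∑ z : TorusSite 2 L, if z = x ∧ z + Pi.single i 1 = y then K else 0) =
      ∑ z : TorusSite 2 L, if z = x then (if x + Pi.single i 1 = y then K else 0) else 0 from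
    Finset.sum_congr rfl fun z _ => by
      by_cases hz : z = x
      · subst hz; simp
      · simp [hz]]
  rw [Finset.sum_ite_eq' Finset.univ x, if_pos (Finset.mem_univ x)]
  split_ifs <;> simp

omit [NeZero L] in
/-- Distinct directions give distinct unit vectors (`L ≥ 2`). [cite: Lieb1980, Theorem 4 — plumbing] -/
private theorem torusXY_single_inj (hL : 2 ≤ L) {i i' : Fin 2}
    (h : (Pi.single i 1 : TorusSite 2 L) = Pi.single i' 1) : i = i' := by
  by_contra hne
  haveI : Fact (1 < L) := ⟨by omega⟩
  have := congrFun h i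
  rw [Pi.single_eq_same, Pi.single_eq_of_ne hne] at this
  exact one_ne_zero this

omit [NeZero L] in
/-- No back-and-forth: `x + eᵢ + e_{i'} ≠ x` on `(ℤ/Lℤ)²` for `L ≥ 3`. [cite: Lieb1980, Theorem 4 — plumbing] -/
private theorem torusXY_single_add_single_ne_zero (hL : 3 ≤ L) (i i' : Fin 2) :
    (Pi.single i 1 : TorusSite 2 L) + Pi.single i' 1 ≠ 0 := by
  intro h
  haveI : Fact (1 < L) := ⟨by omega⟩
  have hi := congrFun h i
  rw [Pi.add_apply, Pi.single_eq_same, Pi.zero_apply] at hi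
  by_cases hii : i' = i
  · subst hii
    rw [Pi.single_eq_same] at hi
    have h2 : ((2 : ℕ) : ZMod L) = 0 := by exact_mod_cast (show (1 + 1 : ZMod L) = 0 from hi)
    rw [ZMod.natCast_eq_zero_iff] at h2
    exact absurd (Nat.le_of_dvd two_pos h2) (by omega)
  · rw [Pi.single_eq_of_ne (Ne.symm hii) , add_zero] at hi
    exact one_ne_zero hi

omit [NeZero L] in
/-- `ν(x,y) ∈ {0, 1}` (`L ≥ 2`): two distinct unit vectors cannot both join `x` to `y`. [cite: Lieb1980, Theorem 4 — plumbing] -/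
private theorem nbr_eq_zero_or_one (hL : 2 ≤ L) (x y : TorusSite 2 L) :
    (∑ i : Fin 2, if x + Pi.single i 1 = y then (1 : ℝ) else 0) = 0 ∨
      (∑ i : Fin 2, if x + Pi.single i 1 = y then (1 : ℝ) else 0) = 1 := by
  rw [Fin.sum_univ_two]
  by_cases h0 : x + Pi.single 0 1 = y <;> by_cases h1 : x + Pi.single 1 1 = y
  · exfalso
    have : (Pi.single (0 : Fin 2) 1 : TorusSite 2 L) = Pi.single 1 1 :=
      add_left_cancel (h0.trans h1.symm)
    exact absurd (torusXY_single_inj hL this) (by decide)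
  all_goals simp [h0, h1]

omit [NeZero L] in
/-- `ν(x,y) ≤ 1` (`L ≥ 2`). [cite: Lieb1980, Theorem 4 — plumbing] -/
private theorem nbr_le_one (hL : 2 ≤ L) (x y : TorusSite 2 L) :
    (∑ i : Fin 2, if x + Pi.single i 1 = y then (1 : ℝ) else 0) ≤ 1 := by
  rcases nbr_eq_zero_or_one hL x y with h | h <;> simp [h]

omit [NeZero L] in
/-- `ν(x,y) + ν(y,x) ≤ 1` (`L ≥ 3`): two sites are joined by at most one bond, in one orientation.
[cite: Lieb1980, Theorem 4 — plumbing] -/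
private theorem nbr_add_nbr_le_one (hL : 3 ≤ L) (x y : TorusSite 2 L) :
    (∑ i : Fin 2, if x + Pi.single i 1 = y then (1 : ℝ) else 0) +
      (∑ i : Fin 2, if y + Pi.single i 1 = x then (1 : ℝ) else 0) ≤ 1 := by
  have hxy := nbr_le_one (by omega) x y
  have hyx := nbr_le_one (by omega) y x
  -- if `ν(x,y) > 0` then `ν(y,x) = 0`
  by_cases h : ∃ i : Fin 2, x + Pi.single i 1 = y
  · obtain ⟨i, hi⟩ := h
    have h0 : (∑ i : Fin 2, if y + Pi.single i 1 = x then (1 : ℝ) else 0) = 0 := by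
      refine Finset.sum_eq_zero fun i' _ => ?_
      rw [if_neg]
      intro h'
      apply torusXY_single_add_single_ne_zero hL i i'
      have : x + (Pi.single i 1 + Pi.single i' 1) = x := by rw [← add_assoc, hi, h']
      exact add_left_cancel (this.trans (add_zero x).symm)
    rw [h0, add_zero]; exact hxy
  · have h0 : (∑ i : Fin 2, if x + Pi.single i 1 = y then (1 : ℝ) else 0) = 0 := by
      refine Finset.sum_eq_zero fun i _ => ?_
      rw [if_neg fun hi => h ⟨i, hi⟩]
    rw [h0, zero_add]; exact hyx

/-- `∑_y ν(x,y) = 2`: each site has two forward bonds. [cite: Lieb1980, Theorem 4 — plumbing] -/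
private theorem sum_nbr_left (x : TorusSite 2 L) :
    ∑ y : TorusSite 2 L, (∑ i : Fin 2, if x + Pi.single i 1 = y then (1 : ℝ) else 0) = 2 := by
  rw [Finset.sum_comm]
  simp only [Finset.sum_ite_eq, Finset.mem_univ, if_true, Finset.sum_const, Finset.card_univ,
    Fintype.card_fin]
  norm_num

/-- `∑_y ν(y,x) = 2`: each site has two backward bonds. [cite: Lieb1980, Theorem 4 — plumbing] -/
private theorem sum_nbr_right (x : TorusSite 2 L) :
    ∑ y : TorusSite 2 L, (∑ i : Fin 2, if y + Pi.single i 1 = x then (1 : ℝ) else 0) = 2 := by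
  rw [Finset.sum_comm]
  have h : ∀ i : Fin 2, (∑ y : TorusSite 2 L, if y + Pi.single i 1 = x then (1 : ℝ) else 0) = 1 := by
    intro i
    rw [show (∑ y : TorusSite 2 L, if y + Pi.single i 1 = x then (1 : ℝ) else 0) =
        ∑ y : TorusSite 2 L, if y = x - Pi.single i 1 then 1 else 0 from
      Finset.sum_congr rfl fun y _ => by
        by_cases hy : y + Pi.single i 1 = x
        · rw [if_pos hy, if_pos (eq_sub_of_add_eq hy)]
        · rw [if_neg hy, if_neg fun h2 => hy (by rw [h2, sub_add_cancel])]]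
    rw [Finset.sum_ite_eq', if_pos (Finset.mem_univ _)]
  simp only [h, Finset.sum_const, Finset.card_univ, Fintype.card_fin]
  norm_num

/-- **The Bessel-ratio row sums of the torus**: for `L ≥ 3`, `K ≥ 0` and every site `x` of `(ℤ/Lℤ)²`,
`∑_{y ≠ x} u(J(x,y) + J(y,x)) ≤ 4u(K)`, `J` the fibre-summed pair coupling of `torusXY 2 L` at uniform coupling `K`,
`u = I₁/I₀` (in fact with equality: four neighbours, each pair coupled once). [cite: Lieb1980, Theorem 4 (ν = 2: the criterion I₁(β)/I₀(β) < 1/4)] -/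
theorem torusXY_besselRatio_rowSum_le (hL : 3 ≤ L) {K : ℝ} (hK : 0 ≤ K) (x : TorusSite 2 L) :
    ∑ y ∈ Finset.univ.erase x,
      besselI 1 ((torusXY 2 L).pairCoupling (fun _ => K) (x, y) + (torusXY 2 L).pairCoupling (fun _ => K) (y, x)) /
        besselI 0 ((torusXY 2 L).pairCoupling (fun _ => K) (x, y) + (torusXY 2 L).pairCoupling (fun _ => K) (y, x)) ≤
      4 * besselRatio K := by
  have hu := besselRatio_nonneg hK
  have hterm : ∀ y, besselI 1 ((torusXY 2 L).pairCoupling (fun _ => K) (x, y) +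
      (torusXY 2 L).pairCoupling (fun _ => K) (y, x)) /
        besselI 0 ((torusXY 2 L).pairCoupling (fun _ => K) (x, y) +
          (torusXY 2 L).pairCoupling (fun _ => K) (y, x)) ≤ ((∑ i : Fin 2, if x + Pi.single i 1 = y then (1 : ℝ) else 0) + (∑ i : Fin 2, if y + Pi.single i 1 = x then (1 : ℝ) else 0)) * besselRatio K := by
    intro y
    rw [pairCoupling_torusXY, pairCoupling_torusXY, ← mul_add]
    -- `ν(x,y) + ν(y,x) ∈ {0, 1}`
    have hle := nbr_add_nbr_le_one hL x y
    have hint : (∑ i : Fin 2, if x + Pi.single i 1 = y then (1 : ℝ) else 0) + (∑ i : Fin 2, if y + Pi.single i 1 = x then (1 : ℝ) else 0) = 0 ∨ (∑ i : Fin 2, if x + Pi.single i 1 = y then (1 : ℝ) else 0) + (∑ i : Fin 2, if y + Pi.single i 1 = x then (1 : ℝ) else 0) = 1 := by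
      -- both summands are sums of `0/1` indicators
      have hx := nbr_eq_zero_or_one (by omega) x y
      have hy := nbr_eq_zero_or_one (by omega) y x
      rcases hx with hx | hx <;> rcases hy with hy | hy
      · left; rw [hx, hy]; norm_num
      · right; rw [hx, hy]; norm_num
      · right; rw [hx, hy]; norm_num
      · exfalso; rw [hx, hy] at hle; norm_num at hle
    rcases hint with h0 | h1
    · rw [h0, mul_zero, zero_mul, besselI_zero_right]
      simp
    · rw [h1, mul_one, one_mul, besselRatio]
  calc ∑ y ∈ Finset.univ.erase x, besselI 1 ((torusXY 2 L).pairCoupling (fun _ => K) (x, y) +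
          (torusXY 2 L).pairCoupling (fun _ => K) (y, x)) /
          besselI 0 ((torusXY 2 L).pairCoupling (fun _ => K) (x, y) +
            (torusXY 2 L).pairCoupling (fun _ => K) (y, x))
      ≤ ∑ y ∈ Finset.univ.erase x, ((∑ i : Fin 2, if x + Pi.single i 1 = y then (1 : ℝ) else 0) + (∑ i : Fin 2, if y + Pi.single i 1 = x then (1 : ℝ) else 0)) * besselRatio K := Finset.sum_le_sum fun y _ => hterm y
    _ ≤ ∑ y, ((∑ i : Fin 2, if x + Pi.single i 1 = y then (1 : ℝ) else 0) + (∑ i : Fin 2, if y + Pi.single i 1 = x then (1 : ℝ) else 0)) * besselRatio K :=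
        Finset.sum_le_sum_of_subset_of_nonneg (Finset.erase_subset _ _) fun y _ _ =>
          mul_nonneg (add_nonneg (nbr_nonneg x y) (nbr_nonneg y x)) hu
    _ = 4 * besselRatio K := by
        rw [← Finset.sum_mul, Finset.sum_add_distrib, sum_nbr_left, sum_nbr_right]; norm_num

end RowSum

/-! ## §2 The column distance and Lieb's bound on the torus -/

section ColDist

omit [NeZero L] in
/-- `d_c(c) = 0`. [cite: Lieb1980, Theorem 4 — plumbing] -/
private theorem colDist_self (c : TorusSite 2 L) : ((c 0 - c 0).valMinAbs).natAbs = 0 := by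
  simp

omit [NeZero L] in
/-- `|valMinAbs(eᵢ(0))| ≤ 1` on `ℤ/Lℤ`, `L ≥ 2` (the first coordinate of a unit vector is `0` or `1`).
[cite: Lieb1980, Theorem 4 — plumbing] -/
private theorem natAbs_valMinAbs_single_le (hL : 2 ≤ L) (i : Fin 2) :
    (((Pi.single i 1 : TorusSite 2 L) 0).valMinAbs).natAbs ≤ 1 := by
  by_cases hi : i = 0
  · subst hi
    rw [Pi.single_eq_same]
    have h := ZMod.valMinAbs_natCast_of_le_half (n := L) (a := 1) (by omega)
    rw [Nat.cast_one] at h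
    rw [h]; norm_num
  · rw [Pi.single_eq_of_ne' hi, ZMod.valMinAbs_zero]; norm_num

omit [NeZero L] in
/-- Moving along one bond changes the column distance by at most `1`. [cite: Lieb1980, Theorem 4 — plumbing] -/
private theorem colDist_add_single_le (hL : 2 ≤ L) (c x : TorusSite 2 L) (i : Fin 2) :
    ((x 0 - c 0).valMinAbs).natAbs ≤ (((x + Pi.single i 1 : TorusSite 2 L) 0 - c 0).valMinAbs).natAbs + 1 ∧ (((x + Pi.single i 1 : TorusSite 2 L) 0 - c 0).valMinAbs).natAbs ≤ ((x 0 - c 0).valMinAbs).natAbs + 1 := by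
  have h1 := natAbs_valMinAbs_single_le hL i
  constructor
  · have e : x 0 - c 0 = ((x + Pi.single i 1 : TorusSite 2 L) 0 - c 0) + (-((Pi.single i 1 : TorusSite 2 L) 0)) := by
      rw [Pi.add_apply]; ring
    rw [e]
    refine (ZMod.natAbs_valMinAbs_add_le _ _).trans ((Int.natAbs_add_le _ _).trans ?_)
    rw [ZMod.natAbs_valMinAbs_neg]
    omega
  · have e : (x + Pi.single i 1 : TorusSite 2 L) 0 - c 0 = (x 0 - c 0) + (Pi.single i 1 : TorusSite 2 L) 0 := by
      rw [Pi.add_apply]; ring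
    rw [e]
    refine (ZMod.natAbs_valMinAbs_add_le _ _).trans ((Int.natAbs_add_le _ _).trans ?_)
    omega

variable [MeasurableSpace Circle] [BorelSpace Circle]

/-- **Lieb's bound on the torus `(ℤ/Lℤ)²`**: for `L ≥ 3`, `K ≥ 0` and all sites `a, c`,
`⟨cos(θ_a − θ_c)⟩_{K,L} ≤ (4u(K))^{d_c(a)}`, `d_c(a)` the cyclic distance of the first coordinates — uniformly in
the volume; exponential decay as soon as `4u(K) < 1`. [cite: Lieb1980, Theorem 4 (ν = 2, with eq. (23) for the star / Rivasseau 1980)] -/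
theorem torusXY_expectJ_cosDiff_le_pow_colDist (hL : 3 ≤ L) {K : ℝ} (hK : 0 ≤ K) (c a : TorusSite 2 L) :
    (torusXY 2 L).expectJ (fun _ => K) (cosDiff a c) ≤
      (4 * besselRatio K) ^ ((a 0 - c 0).valMinAbs).natAbs := by
  classical
  rw [(torusXY 2 L).expectJ_cosDiff_eq_twoPoint]
  refine twoPoint_le_pow_of_besselRatio_rowSum_le ((torusXY 2 L).pairCoupling_nonneg fun _ => hK)
    (torusXY_besselRatio_rowSum_le hL hK) c (d := fun x => ((x 0 - c 0).valMinAbs).natAbs) (colDist_self c) ?_ a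
  intro x y _ hJ
  -- a nonzero pair coupling means `y = x + eᵢ` or `x = y + eᵢ`
  rcases hJ with h | h
  · rw [pairCoupling_torusXY] at h
    have : (∑ i : Fin 2, if x + Pi.single i 1 = y then (1 : ℝ) else 0) ≠ 0 := fun h0 => h (by rw [h0, mul_zero])
    obtain ⟨i, -, hi⟩ := Finset.exists_ne_zero_of_sum_ne_zero this
    have hi' : x + Pi.single i 1 = y := by by_contra hc; exact hi (if_neg hc)
    rw [← hi']
    exact (colDist_add_single_le (by omega) c x i).1
  · rw [pairCoupling_torusXY] at h
    have : (∑ i : Fin 2, if y + Pi.single i 1 = x then (1 : ℝ) else 0) ≠ 0 := fun h0 => h (by rw [h0, mul_zero])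
    obtain ⟨i, -, hi⟩ := Finset.exists_ne_zero_of_sum_ne_zero this
    have hi' : y + Pi.single i 1 = x := by by_contra hc; exact hi (if_neg hc)
    rw [← hi']
    exact (colDist_add_single_le (by omega) c y i).2

/-- Lieb's bound with any floor `n ≤ d_c(a)` on the column distance and `4u(K) ≤ 1`:
`0 ≤ ⟨cos(θ_a − θ_c)⟩_{K,L} ≤ (4u(K))^n`. [cite: Lieb1980, Theorem 4 (ν = 2)] -/
theorem torusXY_expectJ_cosDiff_mem_Icc_pow (hL : 3 ≤ L) {K : ℝ} (hK : 0 ≤ K) (h1 : 4 * besselRatio K ≤ 1)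
    (c a : TorusSite 2 L) {n : ℕ} (hn : n ≤ ((a 0 - c 0).valMinAbs).natAbs) :
    (torusXY 2 L).expectJ (fun _ => K) (cosDiff a c) ∈ Set.Icc 0 ((4 * besselRatio K) ^ n) := by
  refine ⟨?_, (torusXY_expectJ_cosDiff_le_pow_colDist hL hK c a).trans
    (pow_le_pow_of_le_one (by have := besselRatio_nonneg hK; positivity) h1 hn)⟩
  have h := (torusXY 2 L).expectJ_reChar_diffChar_nonneg (J := fun _ => K) (fun _ => hK) a c
  have e : (cosDiff a c : (TorusSite 2 L → Circle) → ℝ) = reChar (diffChar a c) := funext fun θ => cosDiff_eq_reChar a c θ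
  rw [e]; exact h

end ColDist

/-! ## §3 The main theorem -/

section Main

variable [MeasurableSpace Circle] [BorelSpace Circle]

omit [MeasurableSpace Circle] [BorelSpace Circle] in
/-- A column has `L` sites: `∑_b cut_j(b) = L`. [cite: FisherBarberJasnow1973, §II — plumbing] -/
private theorem sum_cutProfile (j : ZMod L) : ∑ b : TorusSite 2 L × Fin 2, cutProfile j b = (L : ℝ) := by
  rw [Fintype.sum_prod_type]
  have h : ∀ z : TorusSite 2 L, ∑ i : Fin 2, cutProfile j (z, i) = if z 0 = j then 1 else 0 := by
    intro z
    rw [Fin.sum_univ_two]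
    simp [cutProfile]
  simp_rw [h]
  rw [Fintype.sum_equiv (finTwoArrowEquiv (ZMod L)) (fun z : TorusSite 2 L => if z 0 = j then (1 : ℝ) else 0)
    (fun p => if p.1 = j then 1 else 0) (fun z => by simp [finTwoArrowEquiv]),
    Fintype.sum_prod_type]
  have hin : ∀ x : ZMod L, (∑ _y : ZMod L, if (x, _y).1 = j then (1 : ℝ) else 0) = if x = j then (L : ℝ) else 0 := by
    intro x
    have hf : (fun _y : ZMod L => if (x, _y).1 = j then (1 : ℝ) else 0) = fun _ => if x = j then 1 else 0 := rfl
    rw [hf, Finset.sum_const, Finset.card_univ, ZMod.card, nsmul_eq_mul]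
    split_ifs <;> simp
  rw [Finset.sum_congr rfl fun x _ => hin x, Finset.sum_ite_eq' Finset.univ j, if_pos (Finset.mem_univ j)]

omit [NeZero L] [MeasurableSpace Circle] [BorelSpace Circle] in
/-- `cut_j ≥ 0`. [cite: FisherBarberJasnow1973, §II — plumbing] -/
private theorem cutProfile_nonneg (j : ZMod L) (b : TorusSite 2 L × Fin 2) : 0 ≤ cutProfile j b := by
  unfold cutProfile; split_ifs <;> norm_num


/-- `⟨c·f⟩ = c⟨f⟩`. [cite: Lieb1980, Theorem 4 — plumbing] -/
private theorem expectJ_const_mul' (K c : ℝ) (f : (TorusSite 2 L → Circle) → ℝ) :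
    (torusXY 2 L).expectJ (fun _ => K) (fun θ => c * f θ) = c * (torusXY 2 L).expectJ (fun _ => K) f := by
  rw [(torusXY 2 L).expectJ_eq, (torusXY 2 L).expectJ_eq, ← mul_div_assoc, ← integral_const_mul]
  congr 1
  exact integral_congr_ae (ae_of_all _ fun θ => by ring)

/-- `⟨∑_i f_i⟩ = ∑_i ⟨f_i⟩` for continuous observables. [cite: Lieb1980, Theorem 4 — plumbing] -/
private theorem expectJ_finset_sum' {α : Type*} (K : ℝ) (S : Finset α) {f : α → (TorusSite 2 L → Circle) → ℝ}
    (hf : ∀ i, Continuous (f i)) :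
    (torusXY 2 L).expectJ (fun _ => K) (fun θ => ∑ i ∈ S, f i θ) = ∑ i ∈ S, (torusXY 2 L).expectJ (fun _ => K) (f i) := by
  simp only [(torusXY 2 L).expectJ_eq]
  rw [← Finset.sum_div]
  congr 1
  have hint : ∀ i ∈ S, Integrable (fun θ => f i θ * (torusXY 2 L).weightJ (fun _ => K) θ)
      (torusHaar (TorusSite 2 L)) := fun i _ =>
    integrable_torusHaar_of_continuous ((hf i).mul ((torusXY 2 L).continuous_weightJ _))
  rw [← integral_finsetSum _ hint]
  exact integral_congr_ae (ae_of_all _ fun θ => by simp only [Finset.sum_mul])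

omit [NeZero L] [MeasurableSpace Circle] [BorelSpace Circle] in
/-- Column distances between the cuts `0` and `m = ⌊L/2⌋` and their shifts by `e₁` are all `≥ m − 1`
(`|valMinAbs(±m)| = m`, `|valMinAbs(±(m±1))| ≥ m − 1`). [cite: Lieb1980, Theorem 4 — plumbing] -/
private theorem natAbs_valMinAbs_ge_of_near_half (hL : 4 ≤ L) {a : ZMod L} {δ : ZMod L}
    (ha : a = ((L / 2 : ℕ) : ZMod L) + δ ∨ a = -(((L / 2 : ℕ) : ZMod L) + δ))
    (hδ : (δ.valMinAbs).natAbs ≤ 1) : L / 2 - 1 ≤ (a.valMinAbs).natAbs := by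
  have hm : ((((L / 2 : ℕ) : ZMod L)).valMinAbs).natAbs = L / 2 := by
    rw [ZMod.valMinAbs_natCast_of_le_half (le_refl _), Int.natAbs_natCast]
  -- `|m| ≤ |m + δ| + |−δ|`
  have key : L / 2 ≤ ((((L / 2 : ℕ) : ZMod L) + δ).valMinAbs).natAbs + 1 := by
    have e : ((L / 2 : ℕ) : ZMod L) = (((L / 2 : ℕ) : ZMod L) + δ) + (-δ) := by ring
    have h := ZMod.natAbs_valMinAbs_add_le ((((L / 2 : ℕ) : ZMod L)) + δ) (-δ)
    rw [← e, hm] at h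
    have h2 := (h.trans (Int.natAbs_add_le _ _))
    rw [ZMod.natAbs_valMinAbs_neg] at h2
    omega
  rcases ha with h | h
  · rw [h]; omega
  · rw [h, ZMod.natAbs_valMinAbs_neg]; omega

/-- **The helicity modulus of the plane rotator on `(ℤ/Lℤ)²` is exponentially small in Lieb's high-temperature
phase.** For `L ≥ 4`, `K ≥ 0` and `4u(K) ≤ 1` (`u = I₁/I₀`):
`|βΥ_L(K)| ≤ 4K²L²·(4u(K))^{2(⌊L/2⌋ − 1)}`.
Proof: `βΥ_L = −K²⟨J_{C_0} J_{C_m}⟩` (`m = ⌊L/2⌋`, cut–cut covariance identity); the covariance is a double sum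
over the `L × L` pairs of bonds of the two cuts of bond-current correlations, each bounded by
`2(G(a,c)G(a',c') + G(a,c')G(a',c))` (component correlation inequality) with all four column distances `≥ m − 1`,
so by Lieb's criterion each `G ≤ (4u)^{m−1}`. [cite: Lieb1980, Theorem 4 (high-temperature decay input); BricmontFontaineLandau1977 Appendix Thm A2 (decoupling input); FisherBarberJasnow1973 §II (Υ)] -/
theorem abs_torusXYStiffness_le_lieb (hL : 4 ≤ L) {K : ℝ} (hK : 0 ≤ K) (h1 : 4 * besselRatio K ≤ 1) :
    |torusXYStiffness L K| ≤ 4 * K ^ 2 * (L : ℝ) ^ 2 * (4 * besselRatio K) ^ (2 * (L / 2 - 1)) := by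
  classical
  set m : ℕ := L / 2 with hm
  set A : ℝ := 4 * besselRatio K with hA
  have hA0 : 0 ≤ A := by have := besselRatio_nonneg hK; positivity
  have hL3 : 3 ≤ L := by omega
  -- the two cuts `0` and `m`
  have hj : (0 : ZMod L) ≠ ((m : ℕ) : ZMod L) := by
    intro h
    have h' : ((m : ℕ) : ZMod L) = 0 := h.symm
    rw [ZMod.natCast_eq_zero_iff] at h'
    have : m < L := by omega
    have : 0 < m := by omega
    exact absurd (Nat.le_of_dvd this h') (by omega)
  rw [torusXYStiffness_eq_neg_sq_mul_cutCurrent_covariance K hj, abs_neg, abs_mul, abs_of_nonneg (sq_nonneg K)]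
  -- the covariance as a double sum of bond-current correlations
  have hexp : (torusXY 2 L).expectJ (fun _ => K) (fun θ => cutCurrent 0 θ * cutCurrent (m : ZMod L) θ) =
      ∑ b, ∑ b', cutProfile 0 b * cutProfile (m : ZMod L) b' *
        (torusXY 2 L).expectJ (fun _ => K)
          (fun θ => imChar ((torusXY 2 L).bondChar b) θ * imChar ((torusXY 2 L).bondChar b') θ) := by
    have e : (fun θ => cutCurrent 0 θ * cutCurrent (m : ZMod L) θ) = fun θ : TorusSite 2 L → Circle =>
        ∑ b, ∑ b', cutProfile 0 b * cutProfile (m : ZMod L) b' *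
          (imChar ((torusXY 2 L).bondChar b) θ * imChar ((torusXY 2 L).bondChar b') θ) := by
      funext θ
      simp only [cutCurrent, Finset.sum_mul_sum]
      exact Finset.sum_congr rfl fun b _ => Finset.sum_congr rfl fun b' _ => by ring
    have hcont : ∀ b b' : TorusSite 2 L × Fin 2, Continuous fun θ : TorusSite 2 L → Circle =>
        imChar ((torusXY 2 L).bondChar b) θ * imChar ((torusXY 2 L).bondChar b') θ := fun b b' =>
      (continuous_imChar _).mul (continuous_imChar _)
    have hc2 : ∀ b b' : TorusSite 2 L × Fin 2, Continuous fun θ : TorusSite 2 L → Circle =>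
        cutProfile 0 b * cutProfile (m : ZMod L) b' *
          (imChar ((torusXY 2 L).bondChar b) θ * imChar ((torusXY 2 L).bondChar b') θ) := fun b b' =>
      continuous_const.mul (hcont b b')
    have hc1 : ∀ b : TorusSite 2 L × Fin 2, Continuous fun θ : TorusSite 2 L → Circle =>
        ∑ b', cutProfile 0 b * cutProfile (m : ZMod L) b' *
          (imChar ((torusXY 2 L).bondChar b) θ * imChar ((torusXY 2 L).bondChar b') θ) := fun b =>
      continuous_finsetSum _ fun b' _ => hc2 b b'
    rw [e, expectJ_finset_sum' K Finset.univ (f := fun b θ => ∑ b', cutProfile 0 b * cutProfile (m : ZMod L) b' *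
      (imChar ((torusXY 2 L).bondChar b) θ * imChar ((torusXY 2 L).bondChar b') θ)) hc1]
    refine Finset.sum_congr rfl fun b _ => ?_
    rw [expectJ_finset_sum' K Finset.univ (f := fun b' θ => cutProfile 0 b * cutProfile (m : ZMod L) b' *
      (imChar ((torusXY 2 L).bondChar b) θ * imChar ((torusXY 2 L).bondChar b') θ)) (hc2 b)]
    refine Finset.sum_congr rfl fun b' _ => ?_
    rw [← expectJ_const_mul']
  rw [hexp]
  -- termwise bound `cut·cut·|X| ≤ cut·cut·4A^{2(m-1)}`
  have hterm : ∀ b b' : TorusSite 2 L × Fin 2,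
      |cutProfile 0 b * cutProfile (m : ZMod L) b' *
        (torusXY 2 L).expectJ (fun _ => K)
          (fun θ => imChar ((torusXY 2 L).bondChar b) θ * imChar ((torusXY 2 L).bondChar b') θ)| ≤
        cutProfile 0 b * cutProfile (m : ZMod L) b' * (4 * A ^ (2 * (m - 1))) := by
    rintro ⟨z, i⟩ ⟨z', i'⟩
    unfold cutProfile
    by_cases hb : i = 0 ∧ z 0 = 0
    · by_cases hb' : i' = 0 ∧ z' 0 = (m : ZMod L)
      · obtain ⟨hi, hz⟩ := hb
        obtain ⟨hi', hz'⟩ := hb'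
        subst hi; subst hi'
        rw [if_pos ⟨rfl, hz⟩, if_pos ⟨rfl, hz'⟩]
        simp only [one_mul]
        -- the decoupling by the component correlation inequality
        have hdec := (torusXY 2 L).abs_expectJ_imChar_mul_imChar_le_cosDiff (J := fun _ => K) (fun _ => hK)
          z (z + Pi.single 0 1) z' (z' + Pi.single 0 1)
        have hbc : ∀ w : TorusSite 2 L, (torusXY 2 L).bondChar (w, 0) = diffChar w (w + Pi.single 0 1) :=
          fun w => rfl
        rw [hbc, hbc]
        refine hdec.trans ?_
        -- the four two-point functions, all at column distance `≥ m − 1`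
        have hδ1 : ((1 : ZMod L).valMinAbs).natAbs ≤ 1 := by
          have h := ZMod.valMinAbs_natCast_of_le_half (n := L) (a := 1) (by omega)
          rw [Nat.cast_one] at h; rw [h]; norm_num
        have hδ0 : ((0 : ZMod L).valMinAbs).natAbs ≤ 1 := by rw [ZMod.valMinAbs_zero]; norm_num
        have e1 : (z + Pi.single (0 : Fin 2) 1 : TorusSite 2 L) 0 = z 0 + 1 := by
          rw [Pi.add_apply, Pi.single_eq_same]
        have e1' : (z' + Pi.single (0 : Fin 2) 1 : TorusSite 2 L) 0 = z' 0 + 1 := by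
          rw [Pi.add_apply, Pi.single_eq_same]
        have G1 := torusXY_expectJ_cosDiff_mem_Icc_pow hL3 hK h1 z' z (n := m - 1)
          (natAbs_valMinAbs_ge_of_near_half hL (δ := 0) (Or.inr (by rw [hz, hz']; ring)) hδ0)
        have G2 := torusXY_expectJ_cosDiff_mem_Icc_pow hL3 hK h1 (z' + Pi.single 0 1) (z + Pi.single 0 1)
          (n := m - 1) (natAbs_valMinAbs_ge_of_near_half hL (δ := 0) (Or.inr (by rw [e1, e1', hz, hz']; ring)) hδ0)
        have G3 := torusXY_expectJ_cosDiff_mem_Icc_pow hL3 hK h1 (z' + Pi.single 0 1) z (n := m - 1)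
          (natAbs_valMinAbs_ge_of_near_half hL (δ := 1) (Or.inr (by rw [e1', hz, hz']; ring)) hδ1)
        have G4 := torusXY_expectJ_cosDiff_mem_Icc_pow hL3 hK h1 z' (z + Pi.single 0 1) (n := m - 1)
          (natAbs_valMinAbs_ge_of_near_half hL (δ := -1) (Or.inr (by rw [e1, hz, hz']; ring))
            (by rw [ZMod.natAbs_valMinAbs_neg]; exact hδ1))
        obtain ⟨g1l, g1u⟩ := G1
        obtain ⟨g2l, g2u⟩ := G2
        obtain ⟨g3l, g3u⟩ := G3
        obtain ⟨g4l, g4u⟩ := G4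
        have hP : 0 ≤ A ^ (m - 1) := pow_nonneg hA0 _
        have hsq : A ^ (m - 1) * A ^ (m - 1) = A ^ (2 * (m - 1)) := by rw [← pow_add]; congr 1; ring
        have p1 := mul_le_mul g1u g2u g2l hP
        have p2 := mul_le_mul g3u g4u g4l hP
        rw [hsq] at p1 p2
        linarith
      · rw [if_neg hb']; simp
    · rw [if_neg hb]; simp
  -- sum up
  calc K ^ 2 * |∑ b, ∑ b', cutProfile 0 b * cutProfile (m : ZMod L) b' *
          (torusXY 2 L).expectJ (fun _ => K)
            (fun θ => imChar ((torusXY 2 L).bondChar b) θ * imChar ((torusXY 2 L).bondChar b') θ)|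
      ≤ K ^ 2 * ∑ b, ∑ b', cutProfile 0 b * cutProfile (m : ZMod L) b' * (4 * A ^ (2 * (m - 1))) := by
        refine mul_le_mul_of_nonneg_left ?_ (sq_nonneg K)
        refine (Finset.abs_sum_le_sum_abs _ _).trans (Finset.sum_le_sum fun b _ => ?_)
        exact (Finset.abs_sum_le_sum_abs _ _).trans (Finset.sum_le_sum fun b' _ => hterm b b')
    _ = 4 * K ^ 2 * (L : ℝ) ^ 2 * A ^ (2 * (m - 1)) := by
        have h : ∑ b, ∑ b', cutProfile (0 : ZMod L) b * cutProfile (m : ZMod L) b' * (4 * A ^ (2 * (m - 1))) =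
            (∑ b, cutProfile (0 : ZMod L) b) * (∑ b', cutProfile (m : ZMod L) b') * (4 * A ^ (2 * (m - 1))) := by
          rw [Finset.sum_mul_sum, Finset.sum_mul]
          refine Finset.sum_congr rfl fun b _ => ?_
          rw [Finset.sum_mul]
        rw [h, sum_cutProfile, sum_cutProfile]
        ring

/-- The same with the tree's stiffness floor: **`0 ≤ βΥ_L(K) ≤ 4K²L²·(4u(K))^{2(⌊L/2⌋−1)}`** (`L ≥ 4`, `K ≥ 0`,
`4u(K) ≤ 1`). [cite: Lieb1980, Theorem 4; BricmontFontaineLandau1977 Appendix Thm A2; FisherBarberJasnow1973 §II] -/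
theorem torusXYStiffness_mem_Icc_lieb (hL : 4 ≤ L) {K : ℝ} (hK : 0 ≤ K) (h1 : 4 * besselRatio K ≤ 1) :
    torusXYStiffness L K ∈ Set.Icc 0 (4 * K ^ 2 * (L : ℝ) ^ 2 * (4 * besselRatio K) ^ (2 * (L / 2 - 1))) :=
  ⟨torusXYStiffness_nonneg hK, (le_abs_self _).trans (abs_torusXYStiffness_le_lieb hL hK h1)⟩

end Main

/-! ## §4 Exponential vanishing in Lieb's high-temperature phase -/

section Limit

variable [MeasurableSpace Circle] [BorelSpace Circle]

/-- **`βΥ_L(K) → 0` as `L → ∞` throughout Lieb's high-temperature phase `4u(K) < 1`** (`K ≥ 0`; `K < u⁻¹(¼) ≈ 0.51`,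
i.e. `T > 1.96·J`): the majorant `4K²L²(4u)^{2(⌊L/2⌋−1)}` is a polynomial times a geometric sequence. The
elementary twin (Peierls in the current representation, `K < ½`) is `tendsto_torusXYStiffness_of_lt_half`.
[cite: Lieb1980, Theorem 4 (exponential fall-off for I₁/I₀ < 1/2ν)] -/
theorem tendsto_torusXYStiffness_lieb {K : ℝ} (hK : 0 ≤ K) (h1 : 4 * besselRatio K < 1) :
    Tendsto (fun L : ℕ => torusXYStiffness (L + 1) K) atTop (𝓝 0) := by
  set A : ℝ := 4 * besselRatio K with hA
  have hA0 : 0 ≤ A := by have := besselRatio_nonneg hK; positivity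
  set r : ℝ := A ^ 2 with hr
  have hr0 : 0 ≤ r := by positivity
  have hr1 : |r| < 1 := by
    rw [abs_of_nonneg hr0, hr]
    nlinarith
  -- the majorant along `n ↦ 4K²(2n+4)² r^n`
  have hg : Tendsto (fun n : ℕ => 4 * K ^ 2 * ((2 * (n : ℝ) + 4) ^ 2 * r ^ n)) atTop (𝓝 0) := by
    have h2 := tendsto_pow_const_mul_const_pow_of_abs_lt_one 2 hr1
    have h1' := tendsto_pow_const_mul_const_pow_of_abs_lt_one 1 hr1
    have h0 := tendsto_pow_const_mul_const_pow_of_abs_lt_one 0 hr1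
    have hsum : Tendsto (fun n : ℕ => 4 * ((n : ℝ) ^ 2 * r ^ n) + 16 * ((n : ℝ) ^ 1 * r ^ n) +
        16 * ((n : ℝ) ^ 0 * r ^ n)) atTop (𝓝 0) := by
      have := ((h2.const_mul 4).add (h1'.const_mul 16)).add (h0.const_mul 16)
      simpa using this
    have := hsum.const_mul (4 * K ^ 2)
    rw [mul_zero] at this
    refine this.congr fun n => ?_
    ring
  -- compose with `L ↦ (L+1)/2 − 1 → ∞`
  have hidx : Tendsto (fun L : ℕ => (L + 1) / 2 - 1) atTop atTop := by
    refine tendsto_atTop_atTop.2 fun b => ⟨2 * b + 2, fun L hL => ?_⟩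
    omega
  have hmaj := hg.comp hidx
  -- squeeze for `L + 1 ≥ 4`
  refine tendsto_of_tendsto_of_tendsto_of_le_of_le' tendsto_const_nhds hmaj ?_ ?_
  · exact Eventually.of_forall fun L => torusXYStiffness_nonneg hK
  · filter_upwards [eventually_ge_atTop 3] with L hL
    have hb := abs_torusXYStiffness_le_lieb (L := L + 1) (by omega) hK h1.le
    refine ((le_abs_self _).trans hb).trans ?_
    simp only [Function.comp]
    have hn : ((L + 1 : ℕ) : ℝ) ≤ 2 * (((L + 1) / 2 - 1 : ℕ) : ℝ) + 4 := by
      have : (L + 1 : ℕ) ≤ 2 * ((L + 1) / 2 - 1) + 4 := by omega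
      exact_mod_cast this
    have hpow : A ^ (2 * ((L + 1) / 2 - 1)) = r ^ ((L + 1) / 2 - 1) := by rw [hr, ← pow_mul]
    rw [hpow]
    have hL0 : (0 : ℝ) ≤ ((L + 1 : ℕ) : ℝ) := Nat.cast_nonneg _
    have hrn : 0 ≤ r ^ ((L + 1) / 2 - 1) := pow_nonneg hr0 _
    have hsq : ((L + 1 : ℕ) : ℝ) ^ 2 ≤ (2 * (((L + 1) / 2 - 1 : ℕ) : ℝ) + 4) ^ 2 := pow_le_pow_left₀ hL0 hn 2
    push_cast at hsq ⊢
    nlinarith [sq_nonneg K, mul_nonneg (mul_nonneg (sq_nonneg K) hrn) (sub_nonneg.2 hsq)]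

/-- For every `ε > 0`, eventually in `L`: `0 ≤ βΥ_L(K) < ε` — the would-be stiffness-class exponent
`1/(2π βΥ_L(K))` exceeds every bound along the tori wherever it is defined; with the tree's typing rule
`torusXY_not_uniform_decay_of_tendsto` no volume-uniform decay bound can carry it (crux №2 statement design:
a `Υ`-in-the-exponent statement needs a low-temperature / stiffness-window hypothesis).
[cite: Lieb1980, Theorem 4 (exponential fall-off for I₁/I₀ < 1/2ν)] -/
theorem eventually_torusXYStiffness_lt {K : ℝ} (hK : 0 ≤ K) (h1 : 4 * besselRatio K < 1) {ε : ℝ} (hε : 0 < ε) :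
    ∀ᶠ L : ℕ in atTop, 0 ≤ torusXYStiffness (L + 1) K ∧ torusXYStiffness (L + 1) K < ε := by
  filter_upwards [(tendsto_order.1 (tendsto_torusXYStiffness_lieb hK h1)).2 ε hε] with L hL
  exact ⟨torusXYStiffness_nonneg hK, hL⟩

end Limit

/-! ## §5 Positivity of the finite-volume helicity modulus -/

section Positivity

omit [NeZero L] in
/-- The straight current loop along the row `z₂ = 0` is closed: `∏_{z₂ = 0} θ̄_z θ_{z+e₁} = 1` (the shift
`z ↦ z + e₁` permutes the row). [cite: FisherBarberJasnow1973, §II — plumbing (a single winding loop)] -/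
private theorem twistChar_rowLoop_eq_one [NeZero L] :
    twistChar (torusXY 2 L).bondChar 1
      (fun b : TorusSite 2 L × Fin 2 => if b.2 = 0 ∧ b.1 1 = 0 then (1 : ℤ) else 0) = 1 := by
  classical
  refine ContinuousMonoidHom.ext fun θ => ?_
  rw [twistChar_apply]
  change (1 : Circle) * ∏ a : TorusSite 2 L × Fin 2,
      ((torusXY 2 L).bondChar a θ) ^ (if a.2 = 0 ∧ a.1 1 = 0 then (1 : ℤ) else 0) = 1
  rw [one_mul]
  have hpow : ∀ a : TorusSite 2 L × Fin 2,
      ((torusXY 2 L).bondChar a θ) ^ (if a.2 = 0 ∧ a.1 1 = 0 then (1 : ℤ) else 0) =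
        if a.2 = 0 ∧ a.1 1 = 0 then (θ a.1)⁻¹ * θ (a.1 + Pi.single a.2 1) else 1 := by
    intro a
    split_ifs
    · rw [zpow_one]; rfl
    · rw [zpow_zero]
  simp_rw [hpow]
  rw [← Finset.prod_filter, Finset.prod_mul_distrib]
  -- the shift `a ↦ a + (e₁, 0)` permutes the row
  set F : Finset (TorusSite 2 L × Fin 2) := Finset.univ.filter (fun a => a.2 = 0 ∧ a.1 1 = 0) with hF
  have hshift : ∏ a ∈ F, θ (a.1 + Pi.single a.2 1) = ∏ a ∈ F, θ a.1 := by
    refine Finset.prod_equiv (Equiv.addRight ((Pi.single 0 1, 0) : TorusSite 2 L × Fin 2)) (fun a => ?_)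
      (fun a ha => ?_)
    · simp only [hF, Finset.mem_filter, Finset.mem_univ, true_and, Equiv.coe_addRight, Prod.snd_add,
        Prod.fst_add, add_zero, Pi.add_apply, Pi.single_eq_of_ne (show (1 : Fin 2) ≠ 0 by decide)]
    · obtain ⟨h0, -⟩ := (Finset.mem_filter.1 ha).2
      simp only [Equiv.coe_addRight, Prod.fst_add, h0]
  rw [hshift, Finset.prod_inv_distrib, inv_mul_cancel]

variable [MeasurableSpace Circle] [BorelSpace Circle]

/-- **The finite-volume helicity modulus is strictly positive**: `βΥ_L(K) > 0` for every `K > 0` and every `L ≥ 1`.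
In the dual (integer-current) representation `βΥ_L·L²·Z = ∑_{n closed} ∏_b I_{n_b}(K)·Φ(n)²`
(`torusXYStiffness_mul_card_mul_partitionFnJ_eq_tsum`) every term is `≥ 0` and the straight loop winding once
around the `e₁`-cycle contributes `∏ I_{n_b}(K)·L² > 0`. (So `Υ_∞ = 0` at high temperature is a genuinely
infinite-volume statement; cf. `tendsto_torusXYStiffness_lieb`.) [cite: FisherBarberJasnow1973, §II eqs. (2.4)–(2.5) (helicity modulus); FrohlichPfister1983 Lemma 3.1 (winding representation)] -/
theorem torusXYStiffness_pos {K : ℝ} (hK : 0 < K) : 0 < torusXYStiffness L K := by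
  classical
  have hZ := (torusXY 2 L).partitionFnJ_pos (fun _ => K)
  have hcard : (0 : ℝ) < Fintype.card (TorusSite 2 L) := Nat.cast_pos.2 Fintype.card_pos
  have h := torusXYStiffness_mul_card_mul_partitionFnJ_eq_tsum (L := L) K
  set W : (TorusSite 2 L × Fin 2 → ℤ) → ℝ := fun n =>
    (if twistChar (torusXY 2 L).bondChar 1 n = 1 then ∏ b, besselI (n b) K else 0 : ℝ) *
      (∑ b ∈ Finset.univ.filter (fun b : TorusSite 2 L × Fin 2 => b.2 = 0), (n b : ℝ)) ^ 2 with hW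
  have hs : Summable W := by
    have := (torusXY 2 L).summable_currentWeight_mul_flux_sq (fun _ => K) (torusTwistProfile L)
    refine this.congr fun n => ?_
    rw [hW, sum_torusTwistProfile_mul]
  have hnn : ∀ n, 0 ≤ W n := fun n => by
    refine mul_nonneg ?_ (sq_nonneg _)
    split_ifs
    · exact Finset.prod_nonneg fun b _ => besselI_nonneg hK.le _
    · exact le_rfl
  -- the straight loop
  set n₀ : TorusSite 2 L × Fin 2 → ℤ := fun b => if b.2 = 0 ∧ b.1 1 = 0 then 1 else 0 with hn₀
  have hflux : (1 : ℝ) ≤ ∑ b ∈ Finset.univ.filter (fun b : TorusSite 2 L × Fin 2 => b.2 = 0), (n₀ b : ℝ) := by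
    have hmem : ((0 : TorusSite 2 L), (0 : Fin 2)) ∈
        Finset.univ.filter (fun b : TorusSite 2 L × Fin 2 => b.2 = 0) := by simp
    have h1 : (n₀ ((0 : TorusSite 2 L), (0 : Fin 2)) : ℝ) = 1 := by simp [hn₀]
    rw [← h1]
    refine Finset.single_le_sum (f := fun b : TorusSite 2 L × Fin 2 => (n₀ b : ℝ)) (fun b _ => ?_) hmem
    simp only [hn₀]
    split_ifs <;> simp
  have hterm : 0 < W n₀ := by
    rw [hW]
    simp only
    rw [if_pos twistChar_rowLoop_eq_one]
    refine mul_pos (Finset.prod_pos fun b _ => besselI_pos hK _) ?_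
    nlinarith
  have hle : W n₀ ≤ ∑' n, W n := hs.le_tsum n₀ fun n _ => hnn n
  have hpos : 0 < torusXYStiffness L K * Fintype.card (TorusSite 2 L) * (torusXY 2 L).partitionFnJ (fun _ => K) := by
    rw [h]; exact hterm.trans_le hle
  have h2 : 0 < torusXYStiffness L K * (Fintype.card (TorusSite 2 L) : ℝ) :=
    (mul_pos_iff_of_pos_right hZ).1 hpos
  exact (mul_pos_iff_of_pos_right hcard).1 h2

end Positivity

/-! ## §6 The crux corollary: no volume-uniform decay bound with the stiffness in the exponent -/

section Crux

open Literature.MathematicalPhysics.QuantumLattice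

variable [MeasurableSpace Circle] [BorelSpace Circle]

/-- **No stiffness-class decay bound at high temperature.** Let `K > 0` with `4u(K) < 1`, `A` real, `B > 0`. It is
FALSE that for every `L ≥ 3` and all sites `x, y` of `(ℤ/Lℤ)²`
`|⟨cos(θ_x − θ_y)⟩_{K,L}| ≤ A · B^{η_L} · (dist(x,y) + 1)^{−η_L}` with the stiffness-class exponent
`η_L = 1/(2π·βΥ_L(K))` — because `βΥ_L(K) > 0` (`torusXYStiffness_pos`) and `βΥ_L(K) → 0`
(`tendsto_torusXYStiffness_lieb`) make `η_L → +∞`, which the tree's typing rule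
`torusXY_not_uniform_decay_of_tendsto` (the Ginibre path floor) forbids. Reading (crux №2 statement design):
a finite-volume `Υ_L`-in-the-exponent statement with constants uniform in `L` is refuted in the whole Lieb phase;
it must carry a low-temperature / stiffness-window hypothesis or the `L → ∞` stiffness.
[cite: Lieb1980, Theorem 4 (high-temperature input); McBryanSpencer1977 main theorem (form of the bound)] -/
theorem torusXY_not_uniform_decay_stiffnessExponent {K : ℝ} (hK : 0 < K) (h1 : 4 * besselRatio K < 1) (A : ℝ)
    {B : ℝ} (hB : 0 < B) :
    ¬ ∀ (L : ℕ) [NeZero L], 3 ≤ L → ∀ x y : TorusSite 2 L,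
        |(torusXY 2 L).expect K 1 (cosDiff x y)| ≤
          A * (B ^ (1 / (2 * Real.pi * torusXYStiffness L K)) *
            ((torusDist x y : ℝ) + 1) ^ (-(1 / (2 * Real.pi * torusXYStiffness L K)))) := by
  classical
  -- the exponent as a total function of `L`
  set f : ℕ → ℝ := fun L => if h : L = 0 then 0 else
    1 / (2 * Real.pi * @torusXYStiffness _ _ L ⟨h⟩ K) with hf
  have hfL : ∀ (L : ℕ) [NeZero L], f L = 1 / (2 * Real.pi * torusXYStiffness L K) := by
    intro L _
    rw [hf]
    simp only [dif_neg (NeZero.ne L)]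
  have hlim : Tendsto f atTop atTop := by
    rw [← tendsto_add_atTop_iff_nat 1]
    have hs : Tendsto (fun L : ℕ => torusXYStiffness (L + 1) K) atTop (𝓝[>] 0) :=
      tendsto_nhdsWithin_iff.2 ⟨tendsto_torusXYStiffness_lieb hK.le h1,
        Eventually.of_forall fun L => torusXYStiffness_pos hK⟩
    have hinv := (hs.inv_tendsto_nhdsGT_zero).const_mul_atTop (inv_pos.2 (by positivity : (0 : ℝ) < 2 * Real.pi))
    refine hinv.congr fun L => ?_
    rw [hfL (L + 1)]
    simp only [Pi.inv_apply, one_div, mul_inv]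
  intro h
  refine torusXY_not_uniform_decay_of_tendsto (d := 2) (by norm_num) hK hlim A hB fun L _ hL x y => ?_
  rw [hfL L]
  exact h L hL x y

end Crux

/-! ## §7 Lieb's bound on the torus in the periodic `ℓ¹` distance -/

section LiebTaxi

open Literature.MathematicalPhysics.QuantumLattice

omit [NeZero L] in
/-- `‖eᵢ‖₁ ≤ 1` on `(ℤ/Lℤ)²` (equality unless `L = 1`). [cite: Lieb1980, Theorem 4 — plumbing (nearest neighbours at distance 1)] -/
private theorem torusNormOne_single_le_one' [NeZero L] (i : Fin 2) :
    torusNormOne (Ls := fun _ : Fin 2 => L) (Pi.single i (1 : ZMod L)) ≤ 1 := by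
  unfold torusNormOne
  rw [Finset.sum_eq_single i (fun j _ hj => by rw [Pi.single_eq_of_ne hj, ZMod.val_zero, Nat.zero_min])
    (fun h => absurd (Finset.mem_univ i) h), Pi.single_eq_same]
  exact cyclicAbs_one_le

variable [MeasurableSpace Circle] [BorelSpace Circle]

/-- **Lieb's Theorem 4 on the periodic lattice `(ℤ/Lℤ)²`, `ℓ¹` form**: for `L ≥ 3`, `K ≥ 0` and all sites `a, c`,
`⟨cos(θ_a − θ_c)⟩_{K,L} ≤ (4u(K))^{dist₁(a,c)}` with the periodic taxi distance `dist₁` (`torusDistOne`) and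
`u = I₁/I₀` — the same rate in every volume; exponential decay of the torus two-point function throughout Lieb's
high-temperature phase `4u(K) < 1` (`K < u⁻¹(¼) ≈ 0.516`), complementing the McBryan–Spencer power law of
`PlaneRotatorPowerLawDecay.lean` valid at every `K`. [cite: Lieb1980, Theorem 4 (ν = 2: exponential fall-off iff I₁(β)/I₀(β) < 1/4; with eq. (23) / Rivasseau 1980)] -/
theorem torusXY_expectJ_cosDiff_le_pow_torusDistOne (hL : 3 ≤ L) {K : ℝ} (hK : 0 ≤ K) (a c : TorusSite 2 L) :
    (torusXY 2 L).expectJ (fun _ => K) (cosDiff a c) ≤ (4 * besselRatio K) ^ torusDistOne a c := by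
  classical
  rw [(torusXY 2 L).expectJ_cosDiff_eq_twoPoint]
  refine twoPoint_le_pow_of_besselRatio_rowSum_le ((torusXY 2 L).pairCoupling_nonneg fun _ => hK)
    (torusXY_besselRatio_rowSum_le hL hK) c (d := fun x => torusDistOne x c) ?_ ?_ a
  · show torusDistOne c c = 0
    simp [torusDistOne, torusNormOne]
  · intro x y _ hJ
    show torusDistOne x c ≤ torusDistOne y c + 1
    -- a nonzero pair coupling means `y = x + eᵢ` or `x = y + eᵢ`; either way `dist₁(x, y) ≤ 1`
    have hxy : torusDistOne x y ≤ 1 := by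
      rcases hJ with h | h
      · rw [pairCoupling_torusXY] at h
        have : (∑ i : Fin 2, if x + Pi.single i 1 = y then (1 : ℝ) else 0) ≠ 0 := fun h0 => h (by rw [h0, mul_zero])
        obtain ⟨i, -, hi⟩ := Finset.exists_ne_zero_of_sum_ne_zero this
        have hi' : x + Pi.single i 1 = y := by by_contra hc; exact hi (if_neg hc)
        rw [← hi', torusDistOne, show x - (x + Pi.single i 1) = -(Pi.single i 1 : TorusSite 2 L) by abel,
          torusNormOne_neg]
        exact torusNormOne_single_le_one' i
      · rw [pairCoupling_torusXY] at h
        have : (∑ i : Fin 2, if y + Pi.single i 1 = x then (1 : ℝ) else 0) ≠ 0 := fun h0 => h (by rw [h0, mul_zero])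
        obtain ⟨i, -, hi⟩ := Finset.exists_ne_zero_of_sum_ne_zero this
        have hi' : y + Pi.single i 1 = x := by by_contra hc; exact hi (if_neg hc)
        rw [← hi', torusDistOne, add_sub_cancel_left]
        exact torusNormOne_single_le_one' i
    calc torusDistOne x c ≤ torusDistOne x y + torusDistOne y c := torusDistOne_triangle x y c
      _ ≤ torusDistOne y c + 1 := by omega

/-- The same for the pure-XY expectation `(torusXY 2 L).expect K 1` of `DisorderedXYModel.lean` (the vocabulary of
the McBryan–Spencer file and of the typing rule), with the floor `0 ≤ ⟨cos(θ_a − θ_c)⟩`: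
`0 ≤ ⟨cos(θ_a − θ_c)⟩_{K,L} ≤ (4u(K))^{dist₁(a,c)}` (`L ≥ 3`, `K ≥ 0`). [cite: Lieb1980, Theorem 4 (ν = 2)] -/
theorem torusXY_expect_cosDiff_mem_Icc_pow_torusDistOne (hL : 3 ≤ L) {K : ℝ} (hK : 0 ≤ K) (a c : TorusSite 2 L) :
    (torusXY 2 L).expect K 1 (cosDiff a c) ∈ Set.Icc 0 ((4 * besselRatio K) ^ torusDistOne a c) := by
  rw [(torusXY 2 L).expect_one_eq_expectJ]
  refine ⟨?_, torusXY_expectJ_cosDiff_le_pow_torusDistOne hL hK a c⟩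
  have h := (torusXY 2 L).expectJ_reChar_diffChar_nonneg (J := fun _ => K) (fun _ => hK) a c
  have e : (cosDiff a c : (TorusSite 2 L → Circle) → ℝ) = reChar (diffChar a c) := funext fun θ => cosDiff_eq_reChar a c θ
  rw [e]; exact h

end LiebTaxi

end Literature.Probability.LatticeModels
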